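import Summits.Ventures.YMGap.RobustBall.RobustAreaLawExplicit
import HarnessLib

/-!
# Robust ball (Y2), area-law side — the AXIS PROFILE (cycle eigenvector), the slab row inequality, the DF criterion at AXIS rate

HONEST FRAMING: venture file of the cell `pub-ymgap` (QuantumFields programme), track ROBUST-BALL, seat rb-p2 (g10). Strong-coupling
finite-lattice statements; nothing about the continuum or Clay.  (1) On the cycle `ℤ/L`, `L ≥ 3`: the profile `g(k) = θ^k + θ^{L−k}`
(`k ∈ [0, L)` the representative) has `g(k+1) + g(k−1) ≤ (θ + θ⁻¹) g(k)` at EVERY `k` (equality off `k = 0`), `g(0) ≥ 1`, `0 < g ≤ 2`,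
`g(R) ≤ 2θ^R` for `2R ≤ L`, `g(k±1) ≤ θ⁻¹ g(k)` (`exists_cycleProfile`).  (2) On the slice `(ℤ/L)^n` of the Durhuus–Fröhlich slab σ-model
(`SlabSpecification`: sites = vertical links of a slab, influence count `m(x,y)`), the AXIS vector `v(y) = g(y_i − p′_i)` obeys
`∑_y m(x,y) v(y) ≤ (2(n−1) + θ + θ⁻¹) v(x)` (`sum_slabInfluence_mul_axis_le`) — so `v` is a SUPERSOLUTION for Dobrushin's matrix `κ·m` once
`κ(2(n−1) + θ + θ⁻¹) ≤ 1`, i.e. `θ = κ(1 + O(κ))` (the single-entry rate) instead of the row-sum rate `2nκ`.  (3) The robust DF criterion at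
AXIS RATE (`abs_loopRatio_le_peelBound_axis`, `abs_loopRatio_le_axis_rate`, `abs_expectation_wilsonLoop_le_axis_rate`): the landed peeling
(`norm_integral_loopObs_le_W`) consumes the perturbed slab two-point function ONLY at the AXIS-separated leg pair `(p′ + R e_ī, p′)`, so a
bound `C₁ e^{−C₂ R}` for such pairs alone gives `|⟨W_{R×T}⟩_{Nβ,W}| ≤ N (N² max(4C₁,1))^T e^{−(C₂/m) R T}` (same proofs, weaker hypothesis).

References: H. Föllmer, LNM 1362 (1988) Ch. I (2.8); Durhuus–Fröhlich CMP 75 (1980); Cao–Nissim–Sheffield arXiv:2509.04688v2 Thm 2.3.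
-/

noncomputable section

open Finset Function
open Literature.Probability.LatticeModels (TorusSite)
open Summit.Ventures.YMGap.Slab (SlabEdge SlabEdge.tgt outEdges inEdges slabInfluence slabNbr)

namespace Summit.Ventures.YMGap.RobustBall.SlabAxisProfile

/-! ### The cycle profile -/

section Cycle

variable {L : ℕ} [NeZero L]

/-- Representatives on the cycle: `(k + 1).val = (k.val + 1) % L` for `L ≥ 2`. [folklore] -/
theorem val_add_one (hL : 2 ≤ L) (k : ZMod L) : (k + 1).val = (k.val + 1) % L := by
  haveI : Fact (1 < L) := ⟨by omega⟩
  rw [ZMod.val_add, ZMod.val_one]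

/-- Representatives on the cycle: `(k + 2).val = (k.val + 2) % L` for `L ≥ 3`. [folklore] -/
theorem val_add_two (hL : 3 ≤ L) (k : ZMod L) : (k + 2).val = (k.val + 2) % L := by
  rw [ZMod.val_add]
  have h2 : (2 : ZMod L).val = 2 := by
    rw [show (2 : ZMod L) = ((2 : ℕ) : ZMod L) by norm_cast, ZMod.val_natCast, Nat.mod_eq_of_lt (by omega)]
  rw [h2]

/-- **The cycle profile.**  For `L ≥ 3` and `0 < θ ≤ 1` there is `g : ℤ/L → ℝ` with `0 < g ≤ 2`, `g(0) ≥ 1`,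
`g(k+1) + g(k−1) ≤ (θ + θ⁻¹)·g(k)` for EVERY `k`, `g(R) ≤ 2θ^R` whenever `2R ≤ L`, and one-step ratios `g(k±1) ≤ θ⁻¹ g(k)` — namely
`g(k) = θ^k + θ^{L−k}`, `k ∈ [0, L)` the representative (an exact eigenvector of the cycle's adjacency off `k = 0`). [folklore] -/
theorem exists_cycleProfile (hL : 3 ≤ L) {θ : ℝ} (hθ0 : 0 < θ) (hθ1 : θ ≤ 1) :
    ∃ g : ZMod L → ℝ, (∀ k, 0 < g k) ∧ (∀ k, g k ≤ 2) ∧ 1 ≤ g 0 ∧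
      (∀ k : ZMod L, g (k + 1) + g (k - 1) ≤ (θ + θ⁻¹) * g k) ∧
      (∀ R : ℕ, 2 * R ≤ L → g (R : ZMod L) ≤ 2 * θ ^ R) ∧
      (∀ k : ZMod L, g (k + 1) ≤ θ⁻¹ * g k) ∧ (∀ k : ZMod L, g (k - 1) ≤ θ⁻¹ * g k) := by
  set g : ZMod L → ℝ := fun k => θ ^ k.val + θ ^ (L - k.val) with hg
  have hpow1 : ∀ m : ℕ, θ ^ m ≤ 1 := fun m => pow_le_one₀ hθ0.le hθ1
  have hθinv : θ * θ⁻¹ = 1 := mul_inv_cancel₀ hθ0.ne'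
  have hmono : ∀ a b : ℕ, a ≤ b → θ ^ b ≤ θ ^ a := fun a b hab => pow_le_pow_of_le_one hθ0.le hθ1 hab
  -- one-step ratios: `θ g(k+1) ≤ g(k)` and `θ g(j) ≤ g(j+1)`
  have hstep : ∀ k : ZMod L, θ * g (k + 1) ≤ g k ∧ θ * g k ≤ g (k + 1) := by
    intro k
    have hm : k.val < L := ZMod.val_lt k
    simp only [hg]
    rw [val_add_one (by omega) k]
    set m := k.val with hmdef
    rcases Nat.lt_or_ge (m + 1) L with h1 | h1
    · rw [Nat.mod_eq_of_lt h1]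
      have e1 : θ * θ ^ (L - (m + 1)) = θ ^ (L - m) := by rw [← pow_succ']; congr 1; omega
      have e2 : θ * θ ^ (m + 1) = θ ^ (m + 2) := by rw [← pow_succ']
      have e3 : θ * θ ^ m = θ ^ (m + 1) := by rw [← pow_succ']
      have e4 : θ * θ ^ (L - m) = θ ^ (L - m + 1) := by rw [← pow_succ']
      constructor
      · rw [mul_add, e1, e2]; linarith [hmono m (m + 2) (by omega)]
      · rw [mul_add, e3, e4]; linarith [hmono (L - (m + 1)) (L - m + 1) (by omega)]
    · rw [show m + 1 = L by omega, Nat.mod_self]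
      simp only [Nat.sub_zero, pow_zero]
      have e1 : θ * θ ^ L = θ ^ (L + 1) := by rw [← pow_succ']
      have e2 : θ ^ (L - m) = θ := by rw [show L - m = 1 by omega, pow_one]
      have e3 : θ * θ ^ m = θ ^ L := by rw [← pow_succ']; congr 1; omega
      constructor
      · rw [mul_add, mul_one, e1, e2]; linarith [hmono m (L + 1) (by omega)]
      · rw [mul_add, e2, e3]; nlinarith [hmono 0 2 (by omega), pow_nonneg hθ0.le L]
  refine ⟨g, fun k => by positivity, fun k => by have := hpow1 k.val; have := hpow1 (L - k.val); simp only [hg]; linarith,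
    by simp only [hg, ZMod.val_zero, pow_zero, Nat.sub_zero]; linarith [pow_nonneg hθ0.le L],
    fun k => ?_, fun R hR => ?_, fun k => ?_, fun k => ?_⟩
  · -- the neighbour inequality, parametrised by `j = k - 1`, `m = j.val`
    set j : ZMod L := k - 1 with hj
    have hk : k = j + 1 := by rw [hj]; ring
    have hk1 : k + 1 = j + 2 := by rw [hj]; ring
    have hm : j.val < L := ZMod.val_lt j
    have hkv : k.val = (j.val + 1) % L := by rw [hk]; exact val_add_one (by omega) j
    have hk1v : (k + 1).val = (j.val + 2) % L := by rw [hk1]; exact val_add_two hL j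
    simp only [hg]
    rw [hkv, hk1v]
    set m := j.val with hmdef
    rcases Nat.lt_or_ge (m + 2) L with h3 | h3
    · -- interior: `m + 2 < L`, equality
      rw [Nat.mod_eq_of_lt (by omega : m + 1 < L), Nat.mod_eq_of_lt h3]
      set a := θ ^ m with ha
      set b := θ ^ (L - m - 2) with hb
      have e1 : θ ^ (L - m) = b * θ ^ 2 := by rw [hb, ← pow_add]; congr 1; omega
      have e2 : θ ^ (m + 1) = a * θ := by rw [ha, pow_succ]
      have e3 : θ ^ (L - (m + 1)) = b * θ := by rw [hb, ← pow_succ]; congr 1; omega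
      have e4 : θ ^ (m + 2) = a * θ ^ 2 := by rw [ha, ← pow_add]
      have e5 : θ ^ (L - (m + 2)) = b := by rw [hb]; congr 1
      rw [e1, e2, e3, e4, e5]
      have : (θ + θ⁻¹) * (a * θ + b * θ) = a * θ ^ 2 + b * θ ^ 2 + a * (θ * θ⁻¹) + b * (θ * θ⁻¹) := by ring
      rw [this, hθinv]
      linarith
    · rcases Nat.lt_or_ge (m + 1) L with h4 | h4
      · -- `m = L - 2`: `k.val = L - 1`, `(k+1).val = 0`, equality
        have hmL : m = L - 2 := by omega
        rw [Nat.mod_eq_of_lt h4, show m + 2 = L by omega, Nat.mod_self]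
        simp only [Nat.sub_zero, pow_zero]
        set b := θ ^ m with hb
        have e1 : θ ^ (L - m) = θ ^ 2 := by rw [show L - m = 2 by omega]
        have e2 : θ ^ (m + 1) = b * θ := by rw [hb, pow_succ]
        have e3 : θ ^ (L - (m + 1)) = θ := by rw [show L - (m + 1) = 1 by omega, pow_one]
        have e4 : θ ^ L = b * θ ^ 2 := by rw [hb, ← pow_add]; congr 1; omega
        rw [e1, e2, e3, e4]
        have : (θ + θ⁻¹) * (b * θ + θ) = b * θ ^ 2 + θ ^ 2 + b * (θ * θ⁻¹) + θ * θ⁻¹ := by ring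
        rw [this, hθinv]
        linarith
      · -- `m = L - 1`: `k.val = 0`, `(k+1).val = 1`, strict supersolution at `k = 0`
        have hmL : m = L - 1 := by omega
        rw [show m + 1 = L by omega, Nat.mod_self, show m + 2 = L + 1 by omega, Nat.add_mod_left,
          Nat.mod_eq_of_lt (by omega : 1 < L)]
        simp only [Nat.sub_zero, pow_zero, pow_one]
        set b := θ ^ (L - 2) with hb
        have e1 : θ ^ (L - 1) = b * θ := by rw [hb, ← pow_succ]; congr 1; omega
        have e2 : θ ^ m = b * θ := by rw [hmL, e1]
        have e3 : θ ^ (L - m) = θ := by rw [show L - m = 1 by omega, pow_one]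
        have e4 : θ ^ L = b * θ ^ 2 := by rw [hb, ← pow_add]; congr 1; omega
        rw [e1, e2, e3, e4]
        have : (θ + θ⁻¹) * (1 + b * θ ^ 2) = θ + b * θ ^ 3 + θ⁻¹ + b * θ * (θ * θ⁻¹) := by ring
        rw [this, hθinv, mul_one]
        -- `θ + bθ ≤ θ⁻¹ + bθ³`, i.e. `(1 - θ²)(1 - bθ²) ≥ 0` after multiplying by `θ > 0`
        have hb1 : b ≤ 1 := hpow1 _
        have hb0 : 0 ≤ b := by positivity
        have hθ2 : θ ^ 2 ≤ 1 := hpow1 2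
        have key : θ * (θ + b * θ) ≤ θ * (θ⁻¹ + b * θ ^ 3) := by
          have : θ * (θ⁻¹ + b * θ ^ 3) = 1 + b * θ ^ 4 := by rw [mul_add, hθinv]; ring
          rw [this]
          nlinarith [mul_nonneg hb0 (sub_nonneg.2 hθ2), mul_nonneg (sub_nonneg.2 hb1) (sub_nonneg.2 hθ2),
            pow_nonneg hθ0.le 2]
        have := le_of_mul_le_mul_left key hθ0
        linarith
  · -- `g(R) ≤ 2 θ^R` for `2R ≤ L`
    have hRL : R < L := by have := NeZero.one_le (n := L); omega
    simp only [hg]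
    rw [ZMod.val_natCast, Nat.mod_eq_of_lt hRL]
    have : θ ^ (L - R) ≤ θ ^ R := pow_le_pow_of_le_one hθ0.le hθ1 (by omega)
    linarith
  · rw [← div_eq_inv_mul]; exact (le_div_iff₀' hθ0).2 (hstep k).1
  · rw [← div_eq_inv_mul]
    have h := (hstep (k - 1)).2
    rw [sub_add_cancel] at h
    exact (le_div_iff₀' hθ0).2 h

end Cycle

/-! ### The slab row inequality for the axis vector -/

section Slab

variable {n L : ℕ} [NeZero L]

/-- Sums over the outgoing edges at `x` are sums over directions. [folklore] -/
theorem sum_outEdges_eq (x : TorusSite n L) (F : SlabEdge n L → ℝ) :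
    ∑ e ∈ outEdges x, F e = ∑ i : Fin n, F (x, i) := by
  classical
  rw [outEdges, Finset.sum_filter, Fintype.sum_prod_type, Finset.sum_comm]
  simp

omit [NeZero L] in
/-- An edge `(y, i)` ends at `x` iff `y = x − e_i`. [folklore] -/
theorem tgt_eq_iff (e : SlabEdge n L) (x : TorusSite n L) :
    e.tgt = x ↔ e.1 = Function.update x e.2 (x e.2 - 1) := by
  constructor <;> intro h <;> funext j <;> by_cases hji : j = e.2
  · have hj := congrFun h j
    subst hji
    simp only [SlabEdge.tgt, Function.update_self] at hj
    rw [Function.update_self, ← hj]; ring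
  · have hj := congrFun h j
    simp only [SlabEdge.tgt, Function.update_of_ne hji] at hj
    rw [Function.update_of_ne hji, hj]
  · subst hji; rw [SlabEdge.tgt, Function.update_self, h, Function.update_self]; ring
  · rw [SlabEdge.tgt, Function.update_of_ne hji, h, Function.update_of_ne hji]

/-- Sums over the incoming edges at `x` are sums over directions. [folklore] -/
theorem sum_inEdges_eq (x : TorusSite n L) (F : SlabEdge n L → ℝ) :
    ∑ e ∈ inEdges x, F e = ∑ i : Fin n, F (Function.update x i (x i - 1), i) := by
  classical
  rw [inEdges, Finset.sum_filter, Fintype.sum_prod_type, Finset.sum_comm]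
  refine Finset.sum_congr rfl fun i _ => ?_
  simp only [tgt_eq_iff]
  rw [Finset.sum_ite_eq' Finset.univ (Function.update x i (x i - 1))]
  simp

/-- The influence-weighted sum over any set containing the neighbourhood is the sum over the out- and in-edges. [folklore] -/
theorem sum_slabInfluence_mul_eq (x : TorusSite n L) {S : Finset (TorusSite n L)} (hS : slabNbr x ⊆ S)
    (v : TorusSite n L → ℝ) :
    ∑ y ∈ S, (slabInfluence x y : ℝ) * v y = ∑ e ∈ outEdges x, v e.tgt + ∑ e ∈ inEdges x, v e.1 := by
  classical
  simp only [slabInfluence, Nat.cast_add, add_mul, Finset.sum_add_distrib]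
  congr 1
  · rw [← Finset.sum_fiberwise_of_maps_to (s := outEdges x) (t := S) (g := SlabEdge.tgt)
      (fun e he => hS (by rw [slabNbr]; exact Finset.mem_union_left _ (Finset.mem_image_of_mem _ he)))]
    refine Finset.sum_congr rfl fun y _ => ?_
    rw [Finset.card_eq_sum_ones, Nat.cast_sum, Finset.sum_mul]
    refine Finset.sum_congr rfl fun e he => ?_
    rw [(Finset.mem_filter.1 he).2]; simp
  · rw [← Finset.sum_fiberwise_of_maps_to (s := inEdges x) (t := S) (g := Prod.fst)
      (fun e he => hS (by rw [slabNbr]; exact Finset.mem_union_right _ (Finset.mem_image_of_mem _ he)))]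
    refine Finset.sum_congr rfl fun y _ => ?_
    rw [Finset.card_eq_sum_ones, Nat.cast_sum, Finset.sum_mul]
    refine Finset.sum_congr rfl fun e he => ?_
    rw [(Finset.mem_filter.1 he).2]; simp

/-- **The slab row inequality for the axis vector.**  For a profile `g` on the cycle with
`g(k+1) + g(k−1) ≤ (θ + θ⁻¹) g(k)` and the axis vector `v(y) = g(y_i − p′_i)` (`i` a horizontal direction, `p′` a site):
`∑_y m(x,y) v(y) ≤ (2(n−1) + θ + θ⁻¹) v(x)` at every site `x` — summed over any set `S ⊇ slabNbr x`. [folklore] -/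
theorem sum_slabInfluence_mul_axis_le (x : TorusSite n L) {S : Finset (TorusSite n L)} (hS : slabNbr x ⊆ S)
    {θ : ℝ} {g : ZMod L → ℝ} (hg0 : ∀ k, 0 ≤ g k) (hg : ∀ k : ZMod L, g (k + 1) + g (k - 1) ≤ (θ + θ⁻¹) * g k)
    (i : Fin n) (p' : TorusSite n L) :
    ∑ y ∈ S, (slabInfluence x y : ℝ) * g (y i - p' i) ≤ (2 * ((n : ℝ) - 1) + θ + θ⁻¹) * g (x i - p' i) := by
  classical
  rw [sum_slabInfluence_mul_eq x hS, sum_outEdges_eq, sum_inEdges_eq]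
  simp only [SlabEdge.tgt]
  -- split off the direction `i`
  rw [← Finset.add_sum_erase _ _ (Finset.mem_univ i), ← Finset.add_sum_erase _ _ (Finset.mem_univ i)]
  simp only [Function.update_self]
  have hother : ∀ j ∈ Finset.univ.erase i, g (Function.update x j (x j + 1) i - p' i) = g (x i - p' i) ∧
      g (Function.update x j (x j - 1) i - p' i) = g (x i - p' i) := fun j hj => by
    have hji : i ≠ j := fun h => (Finset.mem_erase.1 hj).1 h.symm
    simp [Function.update_of_ne hji]
  rw [Finset.sum_congr rfl fun j hj => (hother j hj).1, Finset.sum_congr rfl fun j hj => (hother j hj).2,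
    Finset.sum_const, Finset.card_erase_of_mem (Finset.mem_univ i), Finset.card_univ, Fintype.card_fin,
    nsmul_eq_mul]
  have h1 : x i + 1 - p' i = (x i - p' i) + 1 := by ring
  have h2 : x i - 1 - p' i = (x i - p' i) - 1 := by ring
  rw [h1, h2]
  have hk := hg (x i - p' i)
  have hn : ((n - 1 : ℕ) : ℝ) ≤ (n : ℝ) - 1 ∨ n = 0 := by
    rcases Nat.eq_zero_or_pos n with h | h
    · exact Or.inr h
    · left; rw [Nat.cast_sub h]; simp
  rcases hn with hn | hn
  · have hgx := hg0 (x i - p' i)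
    nlinarith
  · exact (Fin.elim0 (hn ▸ i))

end Slab

end Summit.Ventures.YMGap.RobustBall.SlabAxisProfile

/-! ### The robust Durhuus–Fröhlich criterion at AXIS rate -/

namespace Summit.Ventures.YMGap.RobustBall

open MeasureTheory ProbabilityTheory
open Literature.MathematicalPhysics.QuantumLattice (fundamentalRep continuous_fundamentalRep fundamentalRep_apply)
open Literature.MathematicalPhysics.QuantumFieldTheory
open Literature.MathematicalPhysics.QuantumFieldTheory.DurhuusFrohlich

variable {n L N : ℕ} [NeZero L]

section Assembly

variable {W : GaugeConfig (n + 1) L (SU N) → ℝ}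

/-- **The main peeling bound with an AXIS-PAIR hypothesis** (the landed `abs_loopRatio_le_peelBound`, same proof, weaker input):
(HCentre) + (HLoc, range `m`) in direction `j` and perturbed `j`-slab two-point covariances `≤ C₀` between the AXIS-separated sites
`y + R e_ī`, `y` (every height, rest, `y`, `ī`, entries) ⇒ `|⟨W_{R×T}⟩_{Nβ,W}| ≤ N · peelBound N m (4C₀) 0 T` for `2T ≤ L`, `i ≠ j`.
[cite: CaoNissimSheffield2025dynamical, Theorem 2.3] -/
theorem abs_loopRatio_le_peelBound_axis (hN : 2 ≤ N) (β : ℝ) (hWm : Measurable W) (hWb : ∃ C, ∀ U, |W U| ≤ C)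
    {m : ℕ} (hm : 1 ≤ m) {j : Fin (n + 1)} (hloc : HasVerticalRange W j m)
    (hWc : ∀ (t : ZMod L) U, W (slabRotate (centre N (by omega)) j t U) = W U) {R : ℕ} {C₀ : ℝ}
    (hcov : ∀ (t : ZMod L) (r : {e : Edge (n + 1) L // ¬ IsSlab j t e} → SU N) (y : Site n L) (ī : Fin n)
      (i j' k l : Fin N) (φ ψ : ℂ → ℝ), (φ = Complex.re ∨ φ = Complex.im) → (ψ = Complex.re ∨ ψ = Complex.im) →
        |cov[fun Q => φ ((Q (y + Pi.single ī ((R : ℕ) : ZMod L)) : Matrix (Fin N) (Fin N) ℂ) i j'),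
            fun Q => ψ ((((Q y)⁻¹ : Matrix.specialUnitaryGroup (Fin N) ℂ) :
              Matrix (Fin N) (Fin N) ℂ) k l); slabLawW j t β W r]| ≤ C₀)
    (x : Site (n + 1) L) {i : Fin (n + 1)} (hij : i ≠ j) {T : ℕ} (hTL : 2 * T ≤ L) :
    |(∫ U, wilsonLoop (fundamentalRep (Fin N)) x i j R T U * weightW N β W U ∂(linkMeasure n L N)) /
        ∫ U, weightW N β W U ∂(linkMeasure n L N)| ≤
      N * peelBound N m (4 * C₀) 0 T := by
  obtain ⟨ī, hī⟩ := Fin.exists_succAbove_eq hij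
  set p : Site n L := rem j x + Pi.single ī (R : ZMod L) with hp
  set p' : Site n L := rem j x with hp'
  set A : GaugeConfig (n + 1) L (SU N) → Matrix (Fin N) (Fin N) ℂ :=
    fun U => ((leg i (x i) (rem i x) R U : SU N) : Matrix (Fin N) (Fin N) ℂ) with hA
  set B : GaugeConfig (n + 1) L (SU N) → Matrix (Fin N) (Fin N) ℂ :=
    fun U => star ((leg i ((x + Pi.single j ((T : ℕ) : ZMod L) : Site (n + 1) L) i)
      (rem i (x + Pi.single j ((T : ℕ) : ZMod L))) R U : SU N) : Matrix (Fin N) (Fin N) ℂ) with hB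
  -- the perturbed slab two-point bound at the axis-separated pair `(p, p')`, for every height and every rest
  set ε : ℝ := 4 * C₀ with hε
  have hεb : ∀ (t : ZMod L) (r : {e : Edge (n + 1) L // ¬ IsSlab j t e} → SU N) (a b c d : Fin N),
      ‖∫ Q, ((Q p : SU N) : Matrix (Fin N) (Fin N) ℂ) a b * (((Q p')⁻¹ : SU N) : Matrix (Fin N) (Fin N) ℂ) c d
        ∂(slabLawW j t β W r)‖ ≤ ε := by
    intro t r a b c d
    exact norm_integral_entry_mul_inv_entry_slabLawW_le (n := n) (L := L) hN j t β hWm hWb (hWc t) r p p'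
      (C := C₀) (fun i' j' k l φ ψ hφ hψ => hcov t r p' ī i' j' k l φ ψ hφ hψ) a b c d
  have hε0 : 0 ≤ ε := by
    have i0 : Fin N := ⟨0, by omega⟩
    exact (norm_nonneg _).trans (hεb 0 (fun _ => 1) i0 i0 i0 i0)
  -- the sparse peeling induction, from the state `(0, T)` with `K = 1`
  have hmain := norm_integral_loopObs_le_W (N := N) j (x j) p p' β hWm hWb hm hloc hε0 hεb T hTL 0 (by omega) 1
    zero_le_one A B (fun a b => measurable_coe_leg_entry' i _ _ R a b)
    (fun a b => measurable_star_coe_leg_entry' i _ _ R a b)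
    (fun U a b => norm_entry_le _ a b) (fun U a b => norm_star_entry_le' _ a b)
    (isHorizontal_leg' hij _ _ R) (IsHorizontal.seesOnlyAbove (isHorizontal_star_leg' (N := N) hij _ _ R) _ _)
  -- the perturbed expectation as a ratio of integrals
  have hW : ∀ U, wilsonLoop (fundamentalRep (Fin N)) x i j R T U =
      (N : ℝ)⁻¹ * (loopObs j (x j) p p' T A B U).re := fun U => wilsonLoop_eq_loopObs x hī R T U
  set Z := ∫ U, weightW N β W U ∂(linkMeasure n L N) with hZ
  have hZpos : 0 < Z := integral_weightW_pos (n := n) (L := L) (N := N) β hWm hWb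
  have hmeas : Measurable (loopObs j (x j) p p' T A B) :=
    measurable_loopObs j (x j) p p' T (fun a b => measurable_coe_leg_entry' i _ _ R a b)
      (fun a b => measurable_star_coe_leg_entry' i _ _ R a b)
  have hbd : ∀ U, ‖loopObs j (x j) p p' T A B U‖ ≤ (N : ℝ) ^ 3 * (N * 1) := fun U =>
    norm_loopObs_le j (x j) p p' T (fun U a b => norm_entry_le _ a b) (fun U a b => norm_star_entry_le' _ a b) U
  have hint : Integrable (fun U => (weightW N β W U : ℂ) * loopObs j (x j) p p' T A B U) (linkMeasure n L N) :=
    integrable_weightW_mul β hWm hWb hmeas hbd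
  have hnum : ∫ U, wilsonLoop (fundamentalRep (Fin N)) x i j R T U * weightW N β W U ∂(linkMeasure n L N) =
      (N : ℝ)⁻¹ * (∫ U, (weightW N β W U : ℂ) * loopObs j (x j) p p' T A B U ∂(linkMeasure n L N)).re := by
    have h1 := integral_re hint
    simp only [RCLike.re_to_complex, Complex.re_ofReal_mul] at h1
    rw [← h1, ← integral_const_mul]
    refine integral_congr_ae (ae_of_all _ fun U => ?_)
    simp only [hW]
    ring
  change |(∫ U, wilsonLoop (fundamentalRep (Fin N)) x i j R T U * weightW N β W U ∂(linkMeasure n L N)) / Z| ≤ _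
  rw [hnum, abs_div, abs_of_pos hZpos, div_le_iff₀ hZpos, abs_mul, abs_inv, Nat.abs_cast]
  have hNr : (0 : ℝ) < N := by exact_mod_cast (show 0 < N by omega)
  calc (N : ℝ)⁻¹ * |(∫ U, (weightW N β W U : ℂ) * loopObs j (x j) p p' T A B U ∂(linkMeasure n L N)).re|
      ≤ (N : ℝ)⁻¹ * ‖∫ U, (weightW N β W U : ℂ) * loopObs j (x j) p p' T A B U ∂(linkMeasure n L N)‖ :=
        mul_le_mul_of_nonneg_left (Complex.abs_re_le_norm _) (inv_nonneg.2 hNr.le)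
    _ ≤ (N : ℝ)⁻¹ * ((N : ℝ) ^ 2 * 1 * peelBound N m ε 0 T * Z) :=
        mul_le_mul_of_nonneg_left hmain (inv_nonneg.2 hNr.le)
    _ = ((N : ℝ)⁻¹ * N) * N * peelBound N m ε 0 T * Z := by ring
    _ = N * peelBound N m ε 0 T * Z := by rw [inv_mul_cancel₀ hNr.ne', one_mul]

/-- **ROBUST DURHUUS–FRÖHLICH CRITERION AT AXIS RATE**: (HCentre) + (HLoc, range `m`) in direction `j` and an axis-pair bound
`C₁ e^{−C₂ R}` for the perturbed slab two-point covariances ⇒ `|⟨W_{R×T}⟩_{Nβ,W}| ≤ N · (N² · max(4C₁,1))^T · e^{−(C₂/m) R T}`.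
[cite: CaoNissimSheffield2025dynamical, Theorem 2.3] -/
theorem abs_loopRatio_le_axis_rate (hN : 2 ≤ N) (β : ℝ) (hWm : Measurable W) (hWb : ∃ C, ∀ U, |W U| ≤ C)
    {m : ℕ} (hm : 1 ≤ m) {j : Fin (n + 1)} (hloc : HasVerticalRange W j m)
    (hWc : ∀ (t : ZMod L) U, W (slabRotate (centre N (by omega)) j t U) = W U) {R : ℕ} {C₁ C₂ : ℝ} (hC₁ : 0 ≤ C₁)
    (hC₂ : 0 ≤ C₂)
    (hcov : ∀ (t : ZMod L) (r : {e : Edge (n + 1) L // ¬ IsSlab j t e} → SU N) (y : Site n L) (ī : Fin n)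
      (i j' k l : Fin N) (φ ψ : ℂ → ℝ), (φ = Complex.re ∨ φ = Complex.im) → (ψ = Complex.re ∨ ψ = Complex.im) →
        |cov[fun Q => φ ((Q (y + Pi.single ī ((R : ℕ) : ZMod L)) : Matrix (Fin N) (Fin N) ℂ) i j'),
            fun Q => ψ ((((Q y)⁻¹ : Matrix.specialUnitaryGroup (Fin N) ℂ) :
              Matrix (Fin N) (Fin N) ℂ) k l); slabLawW j t β W r]| ≤ C₁ * Real.exp (-C₂ * R))
    (x : Site (n + 1) L) {i : Fin (n + 1)} (hij : i ≠ j) {T : ℕ} (hTL : 2 * T ≤ L) :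
    |(∫ U, wilsonLoop (fundamentalRep (Fin N)) x i j R T U * weightW N β W U ∂(linkMeasure n L N)) /
        ∫ U, weightW N β W U ∂(linkMeasure n L N)| ≤
      N * ((N : ℝ) ^ 2 * max (4 * C₁) 1) ^ T * Real.exp (-(C₂ / m) * ((R : ℝ) * T)) := by
  have h := abs_loopRatio_le_peelBound_axis (n := n) (L := L) (N := N) hN β hWm hWb hm hloc hWc hcov x hij hTL
  have hNr : (0 : ℝ) ≤ N := Nat.cast_nonneg N
  have hp := peelBound_le_full_rate (N := N) hm hC₁ hC₂ R T
  have h4 : 4 * (C₁ * Real.exp (-C₂ * R)) = 4 * C₁ * Real.exp (-C₂ * R) := by ring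
  rw [h4] at h
  calc _ ≤ _ := h
    _ ≤ (N : ℝ) * (((N : ℝ) ^ 2) ^ T * (max (4 * C₁) 1) ^ T * Real.exp (-(C₂ / m) * ((R : ℝ) * T))) :=
        mul_le_mul_of_nonneg_left hp hNr
    _ = N * ((N : ℝ) ^ 2 * max (4 * C₁) 1) ^ T * Real.exp (-(C₂ / m) * ((R : ℝ) * T)) := by rw [mul_pow]; ring

end Assembly

section QuasiLocal

/-- **AXIS-RATE CRITERION for quasi-local gauge perturbations** (`QuasiLocalGaugePerturbation`): (HCentre) + (HLoc, vertical range `m`)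
for `W.total` in every direction and an axis-pair bound `C₁ e^{−C₂ R}` for the perturbed slab laws ⇒ for every `R × T` loop with
`2R, 2T ≤ L`: `|⟨W_{R×T}⟩_{μ_{Nβ,W}}| ≤ N · (N² · max(4C₁,1))^T · e^{−(C₂/m) R T}`. [cite: CaoNissimSheffield2025dynamical, Theorem 2.3] -/
theorem abs_expectation_wilsonLoop_le_axis_rate (hN : 2 ≤ N) (β : ℝ) {b : ℕ}
    (W : QuasiLocalGaugePerturbation (n + 1) L (SU N) b) {m : ℕ} (hm : 1 ≤ m)
    (hloc : ∀ v : Fin (n + 1), HasVerticalRange W.total v m)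
    (hWc : ∀ (v : Fin (n + 1)) (t : ZMod L) U, W.total (slabRotate (centre N (by omega)) v t U) = W.total U)
    {R : ℕ} {C₁ C₂ : ℝ} (hC₁ : 0 ≤ C₁) (hC₂ : 0 ≤ C₂)
    (hcov : ∀ (v : Fin (n + 1)) (t : ZMod L) (r : {e : Edge (n + 1) L // ¬ IsSlab v t e} → SU N) (y : Site n L)
      (ī : Fin n) (i j k l : Fin N) (φ ψ : ℂ → ℝ), (φ = Complex.re ∨ φ = Complex.im) → (ψ = Complex.re ∨ ψ = Complex.im) →
        |cov[fun Q => φ ((Q (y + Pi.single ī ((R : ℕ) : ZMod L)) : Matrix (Fin N) (Fin N) ℂ) i j),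
            fun Q => ψ ((((Q y)⁻¹ : Matrix.specialUnitaryGroup (Fin N) ℂ) :
              Matrix (Fin N) (Fin N) ℂ) k l); slabLawW v t β W.total r]| ≤ C₁ * Real.exp (-C₂ * R))
    (x : Site (n + 1) L) {i j : Fin (n + 1)} (hij : i ≠ j) {T : ℕ} (hTL : 2 * T ≤ L) :
    |W.expectation (fundamentalRep (Fin N)) ((N : ℝ) * β) (wilsonLoop (fundamentalRep (Fin N)) x i j R T)| ≤
      N * ((N : ℝ) ^ 2 * max (4 * C₁) 1) ^ T * Real.exp (-(C₂ / m) * ((R : ℝ) * T)) := by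
  rw [expectation_eq_loopRatio]
  exact abs_loopRatio_le_axis_rate hN β W.measurable_total W.exists_abs_total_le hm (hloc j) (hWc j) hC₁ hC₂
    (hcov j) x hij hTL

end QuasiLocal

end Summit.Ventures.YMGap.RobustBall

end
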